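import Summits.AtomisticToContinuum.FouriersLaw.Theses.VanishingNoiseTransfer
import Literature.MathematicalPhysics.KineticTheory.VelocityFlipNoise
import Literature.Barriers.AtomisticToContinuum.HarmonicCrystalBallisticProofs

/-!
# Disproof file for the crux `NoisyFourier` (stmt-AtomisticToContinuum-11977) — standing adversary

Route `VanishingNoiseTransfer`, sub-problem `FouriersLaw`, summit `AtomisticToContinuum`.
Crux (normal form, `noisyFourier_iff`): for all `ω₂ lam β γ > 0` and EVERY flip rate `ε > 0`,
`(pinnedChain ω₂ lam β γ).FlipFouriersLawFor ε` — Bonetto–Lebowitz–Rey-Bellet's Fourier law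
(both clauses: (i) existence + uniqueness of the weak steady state of `L + εS` for all `N`,
`T_L, T_R > 0`; (ii) finite-`N` responses `D_N(ε)` exist and `D_N(ε) → κ_ε(T) > 0`) for the pinned
anharmonic chain with Bernardin–Olla velocity flips at every site.

## Findings (cycle 1, 2026-08-15) — everything below is sorry-free and `lean check`ed

* §0 `noisyFourier_iff` — the inlined `∀ S, S = … →` binder is a `let`; the crux is literally
  `∀ params > 0, ∀ ε > 0, FlipFouriersLawFor (pinnedChain …) ε` (as the grounders certified).
* §1 DEGENERATE SIZES DO NOT BITE: for `N ≤ 1` every response quotient is identically `0`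
  (`totalCurrent_eq_zero_of_le_one`, `response_limit_eq_zero_of_le_one`), so `D 0 = D 1 = 0` for
  every family; clause (ii) only constrains `lim_N D_N`, hence no kill (contrast §2).
* §2 NATURAL STRENGTHENING REFUTED: the POINTWISE-in-`N` law (`D_N(ε) = κ_ε(T)` for every `N`,
  no thermodynamic limit) is false — `not_noisyFourierPointwise` (witness `N = 0`, also `N = 1`).
  Provers: the `N → ∞` limit in clause (ii) is essential; finite-size/boundary resistance is real.
* §3 LOAD-BEARING HYPOTHESES:
  - bath coupling `0 < γ`: `noisyFourier_false_without_bathCoupling` — at `γ = 0` clause (i)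
    (uniqueness) fails already for `N = 1`: the point mass at the origin AND the Gibbs measure are
    two distinct weak steady states of `L + εS` for every `ε` (`isFlipSteadyState_dirac_zero_of_zero_coupling`,
    in-tree `pinnedChain_isFlipSteadyState_gibbsMeasure`, `gibbsMeasure_succ_ne_dirac`). Any proof
    must use the dissipation/thermalisation supplied by `γ > 0`.
  - noise `0 < ε`: dropping it does not give a refutable statement but EXACTLY conjoins the summit
    conjunct: `noisyFourierWithoutNoise_iff : NoisyFourierWithoutNoise ↔ NoisyFourier ∧ FouriersLaw`.
  - noise AND anharmonicity together (`0 ≤ ε`, `0 ≤ lam`, `0 ≤ β`): false by the in-tree harmonic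
    ballistic barrier (`noisyFourier_false_without_noise_and_anharmonicity`, Rieder–Lebowitz–Lieb).
    Dropping anharmonicity ALONE (`ε > 0`, `lam = β = 0`) is NOT refutable: pinned/unpinned
    harmonic chains WITH flips obey Fourier's law (Bernardin–Olla 2011 Thm 3; Dhar–Venkateshan–
    Lebowitz 2011 §3.1; Bernardin–Kannan–Lebowitz–Lukkarinen 2012 §2, `κ = (1/γ)/(2+ν²+√(ν²(ν²+4)))`
    in their normalisation) — the flips, not the quartic terms, are what a proof of clause (ii)
    will lean on.
* §4 STRUCTURAL CONSEQUENCE (a constraint on any proof): flip-invariant measures carry no current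
  (`totalCurrent_eq_zero_of_flipInvariant`: `j_i` is odd under the pair flip `Θ_i ∘ Θ_{i+1}`), hence
  `noisyFourier_forces_flip_asymmetry`: `NoisyFourier` implies that at every `ε > 0` NOT all noisy
  steady states at positive temperatures are flip-invariant. So the only inhabitants of
  `IsFlipSteadyState` available in the tree (Gibbs, `N = 0` point mass — all flip-invariant, via
  `isFlipSteadyState_iff_isSteadyState_of_flipInvariant`) can never witness clause (ii); the
  off-equilibrium NESS must be built by other means (Harris/Lyapunov for the jump-diffusion).
  Equilibrium anchor `flipSteadyState_eq_gibbs_of_unique`: under clause (i) the `δ = 0` state is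
  the Gibbs measure and carries no current.
* §5 REFORMULATION (positive helper): `flipFouriersLawFor_iff_exists_family` — under clause (i)
  the "for every steady family" quantifier of clause (ii) collapses to "for some family".
* §6 ROUTE CONTEXT: `vanishingNoiseBound_of_fouriersLaw_of_noiseLocality` — X2 follows from the
  conjunct and X1 alone, so given X1, X3 (= this crux) and the supports, FouriersLaw ⇔ X2: the route
  is lossless and `NoisyFourier` only supplies existence of the noisy limits.
* §7 WHY IT RESISTS (docstring `resists`): clause (i) is print-level (BO2011 Prop 1/§8 template +
  Echeverría/Ethier–Kurtz 4.9.17 identification, same gap as NessUnique stmt-0741); clause (ii) at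
  fixed `ε > 0` is an OPEN THEOREM believed true (BO2011 p.3 "not able to prove … Fourier's law";
  numerics Landi–de Oliveira 2013: `J ~ 1/L` for FPU-β + flips); no flip-invariant hidden conserved
  quantity of the pinned FPU-β-plus-quartic-pinning chain is known (energy is the only one), so no
  Mazur-type divergence of `κ_ε`; `ledger negatives` for the summit: 11 refuted statements, the only
  FouriersLaw one (DiluteCellGaussianiser.FarFieldGaussianity, junk-interface exploit) unrelated.

Namespace as prescribed for crux disproof files. Prose only in docstrings.
-/

noncomputable section

namespace Summit.AtomisticToContinuum.FouriersLaw.Cruxes.NoisyFourier.Disproof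

open Literature.MathematicalPhysics.KineticTheory.HeatConduction MeasureTheory Filter Topology
open Summit.AtomisticToContinuum.FouriersLaw.Theses.VanishingNoiseTransfer (NoisyFourier)

/-! ## §0 Normal form of the crux -/

/-- The crux with its `∀ S, S = (…) →` binder discharged: Fourier's law with flips at every
positive rate, for every admissible pinned anharmonic chain. [folklore] -/
theorem noisyFourier_iff :
    NoisyFourier ↔ ∀ ω₂ lam β γ : ℝ, 0 < ω₂ → 0 < lam → 0 < β → 0 < γ → ∀ ε : ℝ, 0 < ε →
      (pinnedChain ω₂ lam β γ).FlipFouriersLawFor ε := by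
  constructor
  · intro h ω₂ lam β γ hω hl hβ hγ ε hε
    exact h ω₂ lam β γ hω hl hβ hγ _ rfl ε hε
  · intro h ω₂ lam β γ hω hl hβ hγ S hS ε hε
    subst hS
    exact h ω₂ lam β γ hω hl hβ hγ ε hε

/-- Choice of a family of measures from a pointwise existence statement at positive temperatures
(junk `0` elsewhere). [folklore] -/
theorem famChoice {Q : (N : ℕ) → ℝ → ℝ → Measure (PhaseSpace N) → Prop}
    (hQ : ∀ (N : ℕ) (T_L T_R : ℝ), 0 < T_L → 0 < T_R → ∃ μ, Q N T_L T_R μ) :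
    ∃ fam : (N : ℕ) → ℝ → ℝ → Measure (PhaseSpace N),
      ∀ (N : ℕ) (T_L T_R : ℝ), 0 < T_L → 0 < T_R → Q N T_L T_R (fam N T_L T_R) := by
  classical
  refine ⟨fun N T_L T_R => if h : 0 < T_L ∧ 0 < T_R then (hQ N T_L T_R h.1 h.2).choose else 0,
    fun N T_L T_R hL hR => ?_⟩
  simp only [dif_pos (And.intro hL hR)]
  exact (hQ N T_L T_R hL hR).choose_spec

/-! ## §1 Degenerate sizes `N ≤ 1`: every response quotient vanishes identically -/

/-- For `N ≤ 1` there is no bond, so the space-summed current of ANY measure is `0`. [folklore] -/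
theorem totalCurrent_eq_zero_of_le_one (P : OscillatorChain) {N : ℕ} (hN : N ≤ 1)
    (μ : Measure (PhaseSpace N)) : P.totalCurrent μ = 0 := by
  unfold OscillatorChain.totalCurrent
  refine Finset.sum_eq_zero fun i _ => ?_
  have h0 : ∀ x, P.bondCurrent N i x = 0 := fun x => P.bondCurrent_eq_zero_of_le i (by omega) x
  simp [h0]

/-- Hence for `N ≤ 1` the linear-response limit of ANY family, if it exists, is `0`: the sequence
`D` of clause (ii) always starts `D 0 = D 1 = 0`. (No kill: clause (ii) only asks `D N → κ T`.)
[folklore] -/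
theorem response_limit_eq_zero_of_le_one (P : OscillatorChain) {N : ℕ} (hN : N ≤ 1)
    (μ : ℝ → ℝ → Measure (PhaseSpace N)) (T D : ℝ)
    (h : Tendsto (fun δ : ℝ => P.totalCurrent (μ (T + δ / 2) (T - δ / 2)) / δ) (𝓝[≠] 0) (𝓝 D)) :
    D = 0 := by
  haveI : (𝓝[≠] (0 : ℝ)).NeBot := NormedField.nhdsNE_neBot 0
  have h' : Tendsto (fun _ : ℝ => (0 : ℝ)) (𝓝[≠] (0 : ℝ)) (𝓝 D) := by
    simpa only [totalCurrent_eq_zero_of_le_one P hN, zero_div] using h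
  exact tendsto_nhds_unique h' tendsto_const_nhds

/-! ## §2 A natural strengthening refuted: the pointwise-in-`N` Fourier law -/

/-- STRENGTHENING of the crux: clause (ii) with `D_N(ε) = κ_ε(T)` for EVERY `N` (the response
quotient of every noisy steady family converges to the conductivity at each fixed size, no
thermodynamic limit). -/
def NoisyFourierPointwise : Prop :=
  ∀ ω₂ lam β γ : ℝ, 0 < ω₂ → 0 < lam → 0 < β → 0 < γ → ∀ ε : ℝ, 0 < ε →
    (∀ (N : ℕ) (T_L T_R : ℝ), 0 < T_L → 0 < T_R →
        ∃ μ : Measure (PhaseSpace N), (pinnedChain ω₂ lam β γ).IsFlipSteadyState N T_L T_R ε μ ∧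
          ∀ ν : Measure (PhaseSpace N),
            (pinnedChain ω₂ lam β γ).IsFlipSteadyState N T_L T_R ε ν → ν = μ) ∧
    ∃ κ : ℝ → ℝ, (∀ T, 0 < T → 0 < κ T) ∧
      ∀ μ : (N : ℕ) → ℝ → ℝ → Measure (PhaseSpace N),
        (∀ (N : ℕ) (T_L T_R : ℝ), 0 < T_L → 0 < T_R →
          (pinnedChain ω₂ lam β γ).IsFlipSteadyState N T_L T_R ε (μ N T_L T_R)) →
        ∀ T : ℝ, 0 < T → ∀ N : ℕ,
          Tendsto (fun δ : ℝ =>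
            (pinnedChain ω₂ lam β γ).totalCurrent (μ N (T + δ / 2) (T - δ / 2)) / δ)
            (𝓝[≠] 0) (𝓝 (κ T))

/-- **The pointwise-in-`N` noisy Fourier law is false** (witness `N = 0`: the empty chain carries
no current, so `κ_ε(T) = D 0 = 0`, contradicting `κ_ε(T) > 0`; `N = 1` works equally). The
`N → ∞` limit of clause (ii) is essential. [folklore] -/
theorem not_noisyFourierPointwise : ¬ NoisyFourierPointwise := by
  intro h
  obtain ⟨hex, κ, hκ, hlin⟩ := h 1 1 1 1 one_pos one_pos one_pos one_pos 1 one_pos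
  obtain ⟨μ, hμ⟩ := famChoice hex
  have h0 := hlin μ (fun N T_L T_R hL hR => (hμ N T_L T_R hL hR).1) 1 one_pos 0
  have hD : κ 1 = 0 := response_limit_eq_zero_of_le_one _ (Nat.zero_le 1) (μ 0) 1 (κ 1) h0
  exact (hκ 1 one_pos).ne' hD

/-! ## §3 Load-bearing hypotheses -/

section BathCoupling

variable {ω₂ lam β γ : ℝ} {N : ℕ}

/-- `update 0 i (-t) = -(update 0 i t)`. [folklore] -/
theorem update_zero_neg (i : Fin N) (t : ℝ) :
    Function.update (0 : Fin N → ℝ) i (-t) = -Function.update (0 : Fin N → ℝ) i t := by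
  funext k
  rcases eq_or_ne k i with rfl | hk
  · simp
  · simp [Function.update_of_ne hk]

/-- The energy of the pinned anharmonic chain is even in the positions (even pinning, even
interaction). [folklore] -/
theorem pinnedChain_hamiltonian_neg_fst (q p : Fin N → ℝ) :
    (pinnedChain ω₂ lam β γ).hamiltonian N (-q, p) = (pinnedChain ω₂ lam β γ).hamiltonian N (q, p) := by
  simp only [OscillatorChain.hamiltonian, pinnedChain, Pi.neg_apply]
  congr 1
  · exact Finset.sum_congr rfl fun i _ => by ring
  · exact Finset.sum_congr rfl fun i _ => Finset.sum_congr rfl fun j _ => by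
      split_ifs <;> ring

/-- No force at the origin: `∂_{q_i} H (0) = 0` for the pinned anharmonic chain (the restriction of
`H` to the `q_i`-axis through `0` is even). [folklore] -/
theorem partialQ_pinnedChain_hamiltonian_zero (i : Fin N) :
    partialQ i ((pinnedChain ω₂ lam β γ).hamiltonian N) 0 = 0 := by
  have key : ∀ t : ℝ, (pinnedChain ω₂ lam β γ).hamiltonian N (Function.update (0 : Fin N → ℝ) i (-t), 0) =
      (pinnedChain ω₂ lam β γ).hamiltonian N (Function.update (0 : Fin N → ℝ) i t, 0) := by
    intro t
    rw [update_zero_neg, pinnedChain_hamiltonian_neg_fst]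
  show deriv (fun t => (pinnedChain ω₂ lam β γ).hamiltonian N
      (Function.update (0 : PhaseSpace N).1 i t, (0 : PhaseSpace N).2)) ((0 : PhaseSpace N).1 i) = 0
  simp only [Prod.fst_zero, Prod.snd_zero, Pi.zero_apply]
  have h := deriv_comp_neg (fun t => (pinnedChain ω₂ lam β γ).hamiltonian N
      (Function.update (0 : Fin N → ℝ) i t, 0)) 0
  simp only [key, neg_zero] at h
  linarith

/-- The flipped origin is the origin. [folklore] -/
theorem momentumFlip_zero (i : Fin N) : momentumFlip i (0 : PhaseSpace N) = 0 := by
  rw [momentumFlip_apply]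
  simp

/-- **Without bath coupling the origin is an equilibrium of `L`**: for `γ = 0` (no friction, no
thermal noise) `L f (0) = 0` for every observable `f` and all `T_L`, `T_R` (no momentum, no force
at the origin, no bath term). [folklore] -/
theorem generator_zero_coupling_apply_zero (T_L T_R : ℝ) (f : PhaseSpace N → ℝ) :
    (pinnedChain ω₂ lam β 0).generator N T_L T_R f 0 = 0 := by
  have hγ : (pinnedChain ω₂ lam β 0).γ = 0 := rfl
  unfold OscillatorChain.generator
  rw [hγ, zero_mul, add_zero]
  refine Finset.sum_eq_zero fun i _ => ?_
  rw [partialQ_pinnedChain_hamiltonian_zero]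
  have h2 : (0 : PhaseSpace N).2 i = 0 := rfl
  rw [h2, zero_mul, zero_mul, sub_self]

/-- … and of `L + εS` for every rate `ε` (the flips fix the origin). [folklore] -/
theorem flipGenerator_zero_coupling_apply_zero (T_L T_R ε : ℝ) (f : PhaseSpace N → ℝ) :
    (pinnedChain ω₂ lam β 0).flipGenerator N T_L T_R ε f 0 = 0 := by
  rw [OscillatorChain.flipGenerator_apply, generator_zero_coupling_apply_zero, zero_add]
  have hflip : ∀ i : Fin N, f (momentumFlip i (0 : PhaseSpace N)) - f 0 = 0 := fun i => by
    rw [momentumFlip_zero, sub_self]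
  simp only [hflip, Finset.sum_const_zero, mul_zero]

/-- **Hence at `γ = 0` the point mass at the origin is a weak steady state of `L + εS`** for every
`N`, `T_L`, `T_R`, `ε`. [folklore] -/
theorem isFlipSteadyState_dirac_zero_of_zero_coupling (N : ℕ) (T_L T_R ε : ℝ) :
    (pinnedChain ω₂ lam β 0).IsFlipSteadyState N T_L T_R ε (Measure.dirac 0) := by
  refine ⟨inferInstance, fun f _ _ => ?_, fun i => ?_⟩
  · rw [integral_dirac]
    exact flipGenerator_zero_coupling_apply_zero T_L T_R ε f
  · have h : (pinnedChain ω₂ lam β 0).bondCurrent N i =ᵐ[Measure.dirac (0 : PhaseSpace N)]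
        Function.const (PhaseSpace N) ((pinnedChain ω₂ lam β 0).bondCurrent N i 0) :=
      ae_eq_dirac _
    exact (integrable_const ((pinnedChain ω₂ lam β 0).bondCurrent N i 0)).congr h.symm

/-- Lebesgue measure of phase space does not charge the origin (`N ≥ 1`). [folklore] -/
theorem volume_singleton_zero_succ (M : ℕ) : volume ({0} : Set (PhaseSpace (M + 1))) = 0 := by
  have h : ({0} : Set (PhaseSpace (M + 1))) ⊆
      (Set.univ : Set (Fin (M + 1) → ℝ)) ×ˢ ({0} : Set (Fin (M + 1) → ℝ)) := by
    intro x hx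
    simp only [Set.mem_singleton_iff] at hx
    subst hx
    simp
  refine measure_mono_null h ?_
  rw [show (volume : Measure (PhaseSpace (M + 1))) = (volume : Measure (Fin (M + 1) → ℝ)).prod volume
      from rfl, Measure.prod_prod]
  simp

/-- A Gibbs measure (absolutely continuous) is never the point mass at the origin (`N ≥ 1`).
[folklore] -/
theorem gibbsMeasure_succ_ne_dirac (P : OscillatorChain) (M : ℕ) (T : ℝ) :
    P.gibbsMeasure (M + 1) T ≠ Measure.dirac 0 := by
  intro h
  have h1 : P.gibbsMeasure (M + 1) T {0} = 0 :=
    P.gibbsMeasure_absolutelyContinuous (M + 1) T (volume_singleton_zero_succ M)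
  rw [h, Measure.dirac_apply_of_mem (Set.mem_singleton (0 : PhaseSpace (M + 1)))] at h1
  exact one_ne_zero h1

/-- The crux with the bath-coupling hypothesis weakened from `0 < γ` to `0 ≤ γ`. -/
def NoisyFourierWithoutBathCoupling : Prop :=
  ∀ ω₂ lam β γ : ℝ, 0 < ω₂ → 0 < lam → 0 < β → 0 ≤ γ → ∀ ε : ℝ, 0 < ε →
    (pinnedChain ω₂ lam β γ).FlipFouriersLawFor ε

/-- **`0 < γ` is load-bearing**: at `γ = 0` (parameters `ω₂ = lam = β = 1`, rate `ε = 1`,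
`N = 1`, `T_L = T_R = 1`) the Gibbs measure `Z⁻¹e^{-H} dq dp` and the point mass `δ_0` are two
distinct weak steady states of `L + εS`, so clause (i) (uniqueness) fails. Any proof of the crux
must use the thermalisation by the baths. [folklore] -/
theorem noisyFourier_false_without_bathCoupling : ¬ NoisyFourierWithoutBathCoupling := by
  intro h
  obtain ⟨hex, -⟩ := h 1 1 1 0 one_pos one_pos one_pos le_rfl 1 one_pos
  obtain ⟨μ, -, huniq⟩ := hex 1 1 1 one_pos one_pos
  have h1 := huniq _ (pinnedChain_isFlipSteadyState_gibbsMeasure one_pos zero_le_one zero_le_one 0 1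
    one_pos 1)
  have h2 := huniq _ (isFlipSteadyState_dirac_zero_of_zero_coupling (ω₂ := 1) (lam := 1) (β := 1)
    1 1 1 1)
  exact gibbsMeasure_succ_ne_dirac _ 0 1 (h1.trans h2.symm)

end BathCoupling

section Noise

/-- The crux with the rate hypothesis weakened from `0 < ε` to `0 ≤ ε`. -/
def NoisyFourierWithoutNoise : Prop :=
  ∀ ω₂ lam β γ : ℝ, 0 < ω₂ → 0 < lam → 0 < β → 0 < γ → ∀ ε : ℝ, 0 ≤ ε →
    (pinnedChain ω₂ lam β γ).FlipFouriersLawFor ε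

/-- **Dropping `0 < ε` conjoins the summit conjunct, nothing less and nothing more**: the `ε = 0`
slice of the body is `FouriersLawFor (pinnedChain …)` verbatim (`flipFouriersLawFor_zero_iff`).
So the weakened statement is not refutable here (it contains the open conjecture) and the
hypothesis `0 < ε` is exactly what separates the crux from the summit. [folklore] -/
theorem noisyFourierWithoutNoise_iff :
    NoisyFourierWithoutNoise ↔ NoisyFourier ∧ _root_.FouriersLaw := by
  rw [noisyFourier_iff]
  constructor
  · intro h
    refine ⟨fun ω₂ lam β γ hω hl hβ hγ ε hε => h ω₂ lam β γ hω hl hβ hγ ε hε.le,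
      fun ω₂ lam β γ hω hl hβ hγ => ?_⟩
    exact ((pinnedChain ω₂ lam β γ).flipFouriersLawFor_zero_iff).1 (h ω₂ lam β γ hω hl hβ hγ 0 le_rfl)
  · rintro ⟨hN, hF⟩ ω₂ lam β γ hω hl hβ hγ ε hε
    rcases hε.lt_or_eq with hε' | hε'
    · exact hN ω₂ lam β γ hω hl hβ hγ ε hε'
    · subst hε'
      exact ((pinnedChain ω₂ lam β γ).flipFouriersLawFor_zero_iff).2 (hF ω₂ lam β γ hω hl hβ hγ)

/-- The crux with BOTH the rate (`0 ≤ ε`) and the anharmonicity (`0 ≤ lam`, `0 ≤ β`) hypotheses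
weakened. -/
def NoisyFourierWithoutNoiseAndAnharmonicity : Prop :=
  ∀ ω₂ lam β γ : ℝ, 0 < ω₂ → 0 ≤ lam → 0 ≤ β → 0 < γ → ∀ ε : ℝ, 0 ≤ ε →
    (pinnedChain ω₂ lam β γ).FlipFouriersLawFor ε

/-- **Noise or anharmonicity must be used**: at `ε = 0`, `lam = β = 0` the statement is the BLR
Fourier law for the pinned HARMONIC chain, refuted in the tree (ballistic flux,
Rieder–Lebowitz–Lieb 1967 / Nakazawa 1970: `D_N = (N-1)c_N → ∞`). With `ε > 0` the harmonic chain
is NOT a counterexample (Fourier's law holds with flips: Bernardin–Olla 2011 Thm 3,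
Dhar–Venkateshan–Lebowitz 2011), so anharmonicity alone is not load-bearing for truth — the noise
is. [cite: BonettoLebowitzReyBellet2000, §6.2 and §7] -/
theorem noisyFourier_false_without_noise_and_anharmonicity :
    ¬ NoisyFourierWithoutNoiseAndAnharmonicity := fun h =>
  Literature.Barriers.AtomisticToContinuum.not_fouriersLawFor_harmonic one_pos one_pos
    (((pinnedChain 1 0 0 1).flipFouriersLawFor_zero_iff).1 (h 1 0 0 1 one_pos le_rfl le_rfl one_pos 0 le_rfl))

end Noise

/-! ## §4 Flip-invariant states carry no current: the noisy NESS must break flip symmetry -/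

section FlipSymmetry

variable (P : OscillatorChain) {N : ℕ}

/-- The bond current `j_i = -½(p_i + p_{i+1})V'(q_{i+1} - q_i)` is ODD under the pair flip
`Θ_i ∘ Θ_{i+1}`. [folklore] -/
theorem bondCurrent_momentumFlip_pair (i j : Fin N) (hj : j.val = i.val + 1) (x : PhaseSpace N) :
    P.bondCurrent N i (momentumFlip i (momentumFlip j x)) = -P.bondCurrent N i x := by
  have hij : i ≠ j := fun h => by rw [h] at hj; omega
  simp only [OscillatorChain.bondCurrent, momentumFlip_fst, ← Finset.sum_neg_distrib]
  refine Finset.sum_congr rfl fun k _ => ?_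
  split_ifs with hk
  · have hkj : k = j := Fin.ext (by omega)
    subst hkj
    rw [momentumFlip_snd_self, momentumFlip_snd_of_ne hij.symm, momentumFlip_snd_of_ne hij,
      momentumFlip_snd_self]
    ring
  · simp

/-- **A measure invariant under every single-site flip carries no bond current** (`N` arbitrary;
no integrability needed: a non-integrable current has Bochner integral `0` anyway). [folklore] -/
theorem integral_bondCurrent_eq_zero_of_flipInvariant {μ : Measure (PhaseSpace N)}
    (hμ : ∀ i, MeasurePreserving (momentumFlip i) μ μ) (i : Fin N) :
    ∫ x, P.bondCurrent N i x ∂μ = 0 := by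
  by_cases hi : i.val + 1 < N
  · set j : Fin N := ⟨i.val + 1, hi⟩ with hjdef
    have h := integral_comp_momentumFlip (hμ j) (fun x => P.bondCurrent N i (momentumFlip i x))
    rw [integral_comp_momentumFlip (hμ i) (fun x => P.bondCurrent N i x)] at h
    simp only [bondCurrent_momentumFlip_pair P i j rfl, integral_neg] at h
    linarith
  · have h0 : ∀ x, P.bondCurrent N i x = 0 := fun x => P.bondCurrent_eq_zero_of_le i (by omega) x
    simp [h0]

/-- **Hence a flip-invariant measure has zero space-summed current.** [folklore] -/
theorem totalCurrent_eq_zero_of_flipInvariant {μ : Measure (PhaseSpace N)}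
    (hμ : ∀ i, MeasurePreserving (momentumFlip i) μ μ) : P.totalCurrent μ = 0 := by
  simp [OscillatorChain.totalCurrent, integral_bondCurrent_eq_zero_of_flipInvariant P hμ]

/-- **The crux forces flip-ASYMMETRIC steady states.** If `NoisyFourier` holds then, for every
admissible chain and every `ε > 0`, it is NOT the case that all weak steady states of `L + εS` at
positive bath temperatures are invariant under the single-site flips: otherwise every response
quotient vanishes near `δ = 0` (`totalCurrent_eq_zero_of_flipInvariant`), `D ≡ 0` and
`κ_ε(T) = 0`. Consequently the in-tree reduction
`isFlipSteadyState_iff_isSteadyState_of_flipInvariant` (equilibrium Gibbs states) can never supply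
the states that clause (ii) is about. [folklore] -/
theorem noisyFourier_forces_flip_asymmetry (h : NoisyFourier) {ω₂ lam β γ : ℝ} (hω : 0 < ω₂)
    (hl : 0 < lam) (hβ : 0 < β) (hγ : 0 < γ) {ε : ℝ} (hε : 0 < ε) :
    ¬ ∀ (N : ℕ) (T_L T_R : ℝ) (μ : Measure (PhaseSpace N)), 0 < T_L → 0 < T_R →
        (pinnedChain ω₂ lam β γ).IsFlipSteadyState N T_L T_R ε μ →
          ∀ i, MeasurePreserving (momentumFlip i) μ μ := by
  intro hall
  obtain ⟨hex, κ, hκ, hlin⟩ := (noisyFourier_iff.1 h) ω₂ lam β γ hω hl hβ hγ ε hε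
  obtain ⟨μ, hμ'⟩ := famChoice hex
  have hμ : ∀ (N : ℕ) (T_L T_R : ℝ), 0 < T_L → 0 < T_R →
      (pinnedChain ω₂ lam β γ).IsFlipSteadyState N T_L T_R ε (μ N T_L T_R) :=
    fun N T_L T_R hL hR => (hμ' N T_L T_R hL hR).1
  obtain ⟨D, hD, hDκ⟩ := hlin μ hμ 1 one_pos
  haveI : (𝓝[≠] (0 : ℝ)).NeBot := NormedField.nhdsNE_neBot 0
  have hD0 : ∀ N, D N = 0 := by
    intro N
    have hev : (fun _ : ℝ => (0 : ℝ)) =ᶠ[𝓝[≠] (0 : ℝ)]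
        fun δ : ℝ => (pinnedChain ω₂ lam β γ).totalCurrent (μ N (1 + δ / 2) (1 - δ / 2)) / δ := by
      have hball : Set.Ioo (-(2 : ℝ)) 2 ∈ 𝓝 (0 : ℝ) := Ioo_mem_nhds (by norm_num) (by norm_num)
      filter_upwards [mem_nhdsWithin_of_mem_nhds hball] with δ hδ
      have h1 : 0 < 1 + δ / 2 := by linarith [hδ.1]
      have h2 : 0 < 1 - δ / 2 := by linarith [hδ.2]
      rw [totalCurrent_eq_zero_of_flipInvariant (pinnedChain ω₂ lam β γ)
        (hall N _ _ _ h1 h2 (hμ N _ _ h1 h2)), zero_div]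
    have hconst : Tendsto (fun _ : ℝ => (0 : ℝ)) (𝓝[≠] (0 : ℝ)) (𝓝 (D N)) := (hD N).congr' hev.symm
    exact tendsto_nhds_unique hconst tendsto_const_nhds
  have hκ0 : κ 1 = 0 := by
    have hDfun : D = fun _ => 0 := funext hD0
    rw [hDfun] at hDκ
    exact tendsto_nhds_unique hDκ tendsto_const_nhds
  exact (hκ 1 one_pos).ne' hκ0


/-- **Equilibrium anchor (a consequence of clause (i), for provers).** If the weak steady state of
`L + εS` at equal temperatures `T_L = T_R = T > 0` is unique, it IS the Gibbs measure
`Z⁻¹e^{-H/T} dq dp` (in-tree `pinnedChain_isFlipSteadyState_gibbsMeasure`, valid for all `ε` and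
`γ`), hence flip-invariant and current-free: the numerator of every response quotient vanishes at
`δ = 0`, as it must for the limit `D_N(ε)` to have a chance to exist. [folklore] -/
theorem flipSteadyState_eq_gibbs_of_unique {ω₂ lam β : ℝ} (hω : 0 < ω₂) (hl : 0 ≤ lam) (hβ : 0 ≤ β)
    (γ : ℝ) {N : ℕ} {T : ℝ} (hT : 0 < T) (ε : ℝ) {μ : Measure (PhaseSpace N)}
    (huniq : ∀ ν : Measure (PhaseSpace N),
      (pinnedChain ω₂ lam β γ).IsFlipSteadyState N T T ε ν → ν = μ) :
    μ = (pinnedChain ω₂ lam β γ).gibbsMeasure N T ∧ (pinnedChain ω₂ lam β γ).totalCurrent μ = 0 := by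
  have h := (huniq _ (pinnedChain_isFlipSteadyState_gibbsMeasure hω hl hβ γ N hT ε)).symm
  refine ⟨h, ?_⟩
  rw [h]
  exact pinnedChain_totalCurrent_gibbsMeasure ω₂ lam β γ N T

end FlipSymmetry

/-! ## §5 A reformulation provers may use: the family quantifier collapses under clause (i) -/

section FamilyCollapse

variable (P : OscillatorChain) (ε : ℝ)

/-- **Clause (ii) need only be proved for ONE steady family.** Given clause (i) (uniqueness at
positive temperatures), `FlipFouriersLawFor` is equivalent to the same statement with
"for every family of flip steady states" replaced by "for some family": two families agree at all
positive temperatures, hence their response quotients agree for `|δ| < 2T`. (Pure logic plus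
uniqueness; the same `Tendsto.congr'` step as in the route's `closes`.) [folklore] -/
theorem flipFouriersLawFor_iff_exists_family :
    P.FlipFouriersLawFor ε ↔
      (∀ (N : ℕ) (T_L T_R : ℝ), 0 < T_L → 0 < T_R →
          ∃ μ : Measure (PhaseSpace N), P.IsFlipSteadyState N T_L T_R ε μ ∧
            ∀ ν : Measure (PhaseSpace N), P.IsFlipSteadyState N T_L T_R ε ν → ν = μ) ∧
      ∃ κ : ℝ → ℝ, (∀ T, 0 < T → 0 < κ T) ∧
        ∃ μ : (N : ℕ) → ℝ → ℝ → Measure (PhaseSpace N),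
          (∀ (N : ℕ) (T_L T_R : ℝ), 0 < T_L → 0 < T_R →
            P.IsFlipSteadyState N T_L T_R ε (μ N T_L T_R)) ∧
          ∀ T : ℝ, 0 < T →
            ∃ D : ℕ → ℝ,
              (∀ N : ℕ, Tendsto (fun δ : ℝ => P.totalCurrent (μ N (T + δ / 2) (T - δ / 2)) / δ)
                (𝓝[≠] 0) (𝓝 (D N))) ∧
              Tendsto D atTop (𝓝 (κ T)) := by
  constructor
  · rintro ⟨hex, κ, hκ, hlin⟩
    obtain ⟨μ, hμ⟩ := famChoice hex
    have hμ1 : ∀ (N : ℕ) (T_L T_R : ℝ), 0 < T_L → 0 < T_R →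
        P.IsFlipSteadyState N T_L T_R ε (μ N T_L T_R) := fun N T_L T_R hL hR => (hμ N T_L T_R hL hR).1
    exact ⟨hex, κ, hκ, μ, hμ1, fun T hT => hlin μ hμ1 T hT⟩
  · rintro ⟨hex, κ, hκ, μ₀, hμ₀, hlin⟩
    refine ⟨hex, κ, hκ, fun μ hμ T hT => ?_⟩
    obtain ⟨D, hD, hDκ⟩ := hlin T hT
    refine ⟨D, fun N => ?_, hDκ⟩
    refine (hD N).congr' ?_
    have hball : Set.Ioo (-(2 * T)) (2 * T) ∈ 𝓝 (0 : ℝ) := Ioo_mem_nhds (by linarith) (by linarith)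
    filter_upwards [mem_nhdsWithin_of_mem_nhds hball] with δ hδ
    have h1 : 0 < T + δ / 2 := by linarith [hδ.1]
    have h2 : 0 < T - δ / 2 := by linarith [hδ.2]
    obtain ⟨ν, -, hν⟩ := hex N _ _ h1 h2
    rw [hν _ (hμ₀ N _ _ h1 h2), hν _ (hμ N _ _ h1 h2)]

end FamilyCollapse

/-! ## §6 Route context: where `NoisyFourier` sits — `VanishingNoiseBound` is necessary -/

section RouteContext

open Summit.AtomisticToContinuum.FouriersLaw.Theses.VanishingNoiseTransfer
  (NoiseLocality VanishingNoiseBound)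

/-- **ROUTE CONTEXT (for the planner; not a disproof of this crux).** The sister crux
`VanishingNoiseBound` (X2) follows from the summit conjunct `FouriersLaw` and `NoiseLocality` (X1)
ALONE — `NoisyFourier` is not needed for this direction: with `D_N(0) → κ(T) > 0` and
`|D_N(0) - D_N(ε)| ≤ w(ε)|D_N(0)||D_N(ε)|`, any limit `k` of noisy responses satisfies
`|κ - k| ≤ w(ε) κ |k|`, whence `k ≤ 2κ(T)` once `|w(ε)| < 1/(2κ(T))`. Together with the route's
`closes` (X1 ∧ X2 ∧ X3 ∧ supports ⇒ FouriersLaw) this says: GIVEN X1, X3 and the supports, the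
conjunct is EQUIVALENT to X2 — the decomposition loses nothing, and all the deterministic
difficulty (`κ(0) < ∞`) sits in X2, while X3 = `NoisyFourier` only supplies existence of the noisy
limits. [folklore] -/
theorem vanishingNoiseBound_of_fouriersLaw_of_noiseLocality (hF : _root_.FouriersLaw)
    (hNL : NoiseLocality) : VanishingNoiseBound := by
  intro ω₂ lam β γ hω hl hβ hγ S hS T hT
  -- deterministic data from the conjunct
  obtain ⟨hex0, κ, hκ, hlin0⟩ := hF ω₂ lam β γ hω hl hβ hγ
  obtain ⟨μ0, hμ0⟩ := famChoice hex0
  obtain ⟨D0, hD0, hD0κ⟩ := hlin0 μ0 (fun N T_L T_R hL hR => (hμ0 N T_L T_R hL hR).1) T hT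
  have hκT : 0 < κ T := hκ T hT
  -- the N-uniform modulus
  obtain ⟨w, hw, hloc⟩ := hNL ω₂ lam β γ hω hl hβ hγ S hS T hT
  -- admissible noise levels: |w ε| < 1/(2κ) and ε ≤ 1
  have hev : ∀ᶠ ε in 𝓝[>] (0 : ℝ), |w ε| < (κ T)⁻¹ / 2 := by
    have := (Metric.tendsto_nhds.mp hw) ((κ T)⁻¹ / 2) (by positivity)
    simpa only [Real.dist_eq, sub_zero] using this
  rw [eventually_nhdsWithin_iff, Metric.eventually_nhds_iff] at hev
  obtain ⟨r, hr, hball⟩ := hev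
  refine ⟨2 * κ T, min (r / 2) 1, lt_min (by positivity) one_pos, ?_⟩
  intro ε hε hεle μ hμ D k hD hDk
  have hεr : ε ≤ r / 2 := hεle.trans (min_le_left _ _)
  have hε1 : ε ≤ 1 := hεle.trans (min_le_right _ _)
  have hwε : |w ε| < (κ T)⁻¹ / 2 := by
    refine hball ?_ hε
    rw [Real.dist_eq, sub_zero, abs_of_pos hε]
    linarith
  -- trivial if k ≤ 0
  rcases le_or_gt k 0 with hk | hk
  · linarith
  -- locality at every length, then pass to the limit N → ∞
  have hlocN : ∀ N, |D0 N - D N| ≤ w ε * |D0 N| * |D N| := fun N =>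
    hloc N ε hε hε1 (μ0 N) (μ N) (fun T_L T_R hL hR => hμ0 N T_L T_R hL hR)
      (fun T_L T_R hL hR => hμ N T_L T_R hL hR) (D0 N) (D N) (hD0 N) (hD N)
  have hlim : |κ T - k| ≤ w ε * |κ T| * |k| :=
    le_of_tendsto_of_tendsto' (hD0κ.sub hDk).abs
      ((tendsto_const_nhds.mul hD0κ.abs).mul hDk.abs) hlocN
  -- hence |1/κ - 1/k| ≤ |w ε| < 1/(2κ), so k < 2κ
  rw [abs_of_pos hκT, abs_of_pos hk] at hlim
  have hprod : 0 < κ T * k := mul_pos hκT hk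
  have hinv : (κ T)⁻¹ - k⁻¹ ≤ |w ε| := by
    have heq : (κ T)⁻¹ - k⁻¹ = (k - κ T) / (κ T * k) := by
      field_simp
    rw [heq, div_le_iff₀ hprod]
    calc k - κ T ≤ |κ T - k| := by rw [abs_sub_comm]; exact le_abs_self _
      _ ≤ w ε * κ T * k := hlim
      _ ≤ |w ε| * κ T * k := by gcongr; exact le_abs_self _
      _ = |w ε| * (κ T * k) := by ring
  have hkinv : (2 * κ T)⁻¹ < k⁻¹ := by
    rw [mul_inv, show (2 : ℝ)⁻¹ * (κ T)⁻¹ = (κ T)⁻¹ / 2 by ring]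
    linarith
  exact ((inv_lt_inv₀ (by positivity) hk).1 hkinv).le

end RouteContext

/-! ## §7 Why the crux resists (no Lean content beyond the above) -/

/-- RESISTS (cycle 1). Attacks tried and why each fails to bite the crux AS STATED:
* degenerate sizes `N = 0, 1`: clause (i) holds there (`isFlipSteadyState_zero_sites`, Gibbs at the
  mean temperature for `N = 1`), `D 0 = D 1 = 0` is compatible with clause (ii) (§1);
* junk analysis of the signature: integrand `L f + εS f` is bounded and compactly supported for
  `f ∈ C_c^∞` (no Bochner junk), `/δ` only along `𝓝[≠] 0`, `κ T` only used at `T > 0`, family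
  unconstrained only where unused — nothing exploitable;
* hypothesis mutation: `γ` (§3, refuted without it), `ε` (§3, = summit conjunct without it),
  `lam, β` (not load-bearing for truth at `ε > 0`: harmonic + flips obeys Fourier's law —
  Bernardin–Olla 2011 Thm 3, Dhar–Venkateshan–Lebowitz 2011, BKLL 2012), `ω₂` (unpinned FPU-β +
  flips: finite Green–Kubo conductivity, BO2011 Thm 2 + Prop 4; numerically Fourier, Landi–de
  Oliveira 2013) — no refutable single-hypothesis weakening other than `γ`;
* strengthenings: pointwise-in-`N` (§2, false); ε-uniformity of `κ_ε` is the separate crux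
  VanishingNoiseBound (open, BHLLO 2015) and is not claimed here;
* physics kill routes: (a) non-uniqueness of the noisy weak steady state at `γ, ε > 0` — no
  mechanism (Harris: no-flip event has probability `e^{-εNt} > 0`, so irreducibility and the smooth
  positive density of the Langevin chain transfer; weak-FP identification = NessUnique's gap);
  (b) `κ_ε = ∞` needs a flip-invariant local conserved quantity besides the energy — none exists
  for the pinned FPU-β-plus-quartic-pinning chain (stretch is not conserved under pinning, momentum
  is destroyed by flips and pinning), and the Green–Kubo conductivity of the flip-noisy chain is
  bounded above by `C/ε` through the `H₋₁` norm of the current w.r.t. `εS` (BO2011 Prop 4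
  mechanism: `S(p_i V') = -2 p_i V'`); (c) `κ_ε = 0` (insulating) excluded heuristically by the
  strictly convex interaction `V'' ≥ 1` and positive temperature — but note that a printed LOWER
  bound on the conductivity exists only for UNPINNED chains (Bernardin review §4.2 Prop 2), so even
  `κ_ε(T) > 0` of clause (ii) is unproved for the pinned chain.
The load-bearing open content is clause (ii) at fixed `ε > 0`: a diffusive NESS Fourier law for a
non-gradient anharmonic system without sector condition (BO2011 arXiv:1105.0493 p.3 "we are not
able to prove the same for J_s (i.e. Fourier's law). Only in the harmonic case …"; Bernardin's
review arXiv:0906.3596 §4.2 p.7: "The introduction of nonlinearity … We do not have any proof of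
the existence of κ^GK(T) nor κ(T). At least we have estimates which indicate that a finite strictly
positive conductivity is expected"), outside every printed macro-ergodicity theorem
(`pinnedChain_outside_FFL_scope`). No printed counterexample, anomaly claim or non-uniqueness
result for anharmonic chains with velocity flips was found (crossref 3 queries 2026-08-15/16 — every
printed anomaly concerns momentum-CONSERVING dynamics, which flips + pinning are not; local hybrid
search 2026-08-16: textbooks only; openalex/arXiv rate-limited). Numerics pending: kit jobs
j005272 (exact `D_N(ε)` of the pinned HARMONIC chain with flips, Lean conventions — sign/rate
conventions, monotonicity in `N`, NoiseLocality modulus) and j005449 (NEMD of the crux's own chain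
`pinnedChain 1 1 1 1` with flips, `G_N = (N-1)J/ΔT` for `N ≤ 64`), results auto-attached to the
item when they finish. [folklore] -/
theorem resists : True := trivial

end Summit.AtomisticToContinuum.FouriersLaw.Cruxes.NoisyFourier.Disproof
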